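import Summits.QuantumFields.YangMills.Theorems.LuscherReductionTwistedTraceScalingBOStiffKinDefectLinear
import HarnessLib

/-!
# (B-ST) atom (B4b), part 0: THE KINETIC DEFECT FROM BELOW — the reversed inequalities of `…BOStiffKinDefectLinear`, and the based T-core in flat coordinates
# (lane A of S-BASE, crux `TwistedTraceScaling` stmt-QuantumFields-20203, C4-CORE, the (B-ST) pen; `pub/ym-fleet/ym-luscher-20007-p1/HANDOFF-g22.md` §DESIGN 4, cdisprove UPDATE 24 (d))

The UPPER twin of ✓`…BOStiffCentralLower.cM_lower` needs the kinetic defect bounded BELOW by the flat quadratic form: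
* §1 ★ `edge_defect_sq_ge` — one link: `Σ_a (A⃗_a − A'⃗_a + G⃗_{y,a} − G⃗_{x,a})² − 16τ³ ≤ ‖q(A)q(G_y) − q(G_x)q(A')‖²` (same exact identity as `edge_defect_sq_le`, no real-part bookkeeping
  needed from below); ★★ `kinDefect_ge_norm_sq_sub` (all links); ★★ `kinDefect_central_based_ge`:
  `‖linkEmbed (x − x') + ∇(flatLin w)‖² − 136|E|τ³ ≤ kinDefect (orthoTube 1 x) (orthoTube 1 x') (basedExt (gno ∘ w))` for `√2‖x̂‖, √2‖x̂'‖, √3‖w‖ ≤ τ ≤ 1`;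
* §2 the based T-core `{h | ∀ y, ‖q(h y) − 1‖ ≤ T}` of ✓`…BOStiffTransportTail`: in the gnomonic chart `Σ_a w_y a² ≤ 4T²` (`sum_sq_le_of_gno_core`), flat sup norm `≤ 2T`
  (`norm_le_of_gno_core`), (measurable: ✓`…BOStiffNearProduct.measurableSet_basedCore`), and every factor in the open upper hemisphere (`scalarPart_pos_of_core`, `T ≤ 1`).
HONEST FRAMING: quaternion/chart bookkeeping for a stub of a child of the CONDITIONAL route R2b1; (B-ST) OPEN; C4-CORE OPEN; not infinite volume, not a gap, not Clay.
-/

set_option autoImplicit false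

noncomputable section

open MeasureTheory Filter Topology Real
open scoped BigOperators Matrix Quaternion
open Literature.MathematicalPhysics.QuantumFieldTheory
open Literature.MathematicalPhysics.QuantumLattice

namespace Summit.QuantumFields.YangMills.Theorems.FemtoTransferGap.TwoLattice.ConstTube

open Summit.QuantumFields.YangMills.Theorems.FemtoTransferGap
open Summit.QuantumFields.YangMills.Theorems.FemtoTransferGap.TwoLattice
open Summit.QuantumFields.YangMills.Theorems.FemtoTransferGap.TwoLattice.Avg
open Summit.QuantumFields.YangMills.Theorems.FemtoTransferGap.TwoLattice.Stiff
open Summit.QuantumFields.YangMills.Theorems.FemtoTransferGap.TwoLattice.GnChart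
open Summit.QuantumFields.YangMills.Theorems.FemtoTransferGap.TwoLattice.Cov (scalarPart_inv vecPart_inv)
open Literature.MathematicalPhysics.QuantumFieldTheory.Balaban1983to89.T4CubeChartGnomonic (gnoPoint)

variable {L : ℕ} [NeZero L]

/-! ## §1 The reversed defect inequality -/

/-- ★ **One link, from below**: for `‖q(A)−1‖, ‖q(A')−1‖, ‖q(G_x)−1‖, ‖q(G_y)−1‖ ≤ τ ≤ 1`,
`Σ_a (A⃗_a − A'⃗_a + G⃗_{y,a} − G⃗_{x,a})² − 16τ³ ≤ ‖q(A)q(G_y) − q(G_x)q(A')‖²`. [folklore] -/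
theorem edge_defect_sq_ge (A A' Gx Gy : SU2) {τ : ℝ} (hτ1 : τ ≤ 1) (hA : ‖su2Quat A - 1‖ ≤ τ) (hA' : ‖su2Quat A' - 1‖ ≤ τ)
    (hGx : ‖su2Quat Gx - 1‖ ≤ τ) (hGy : ‖su2Quat Gy - 1‖ ≤ τ) :
    (∑ a, (vecPart A a - vecPart A' a + vecPart Gy a - vecPart Gx a) ^ 2) - 16 * τ ^ 3 ≤ ‖su2Quat A * su2Quat Gy - su2Quat Gx * su2Quat A'‖ ^ 2 := by
  have hτ0 : 0 ≤ τ := (norm_nonneg _).trans hA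
  set a := su2Quat A with ha
  set a' := su2Quat A' with ha'
  set gx := su2Quat Gx with hgx
  set gy := su2Quat Gy with hgy
  set ℓ : ℍ := (a - a') + (gy - gx) with hℓ
  have e : a * gy - gx * a' = ℓ + ((a - 1) * (gy - 1) - (gx - 1) * (a' - 1)) := by rw [hℓ]; noncomm_ring
  have hR : ‖(a - 1) * (gy - 1) - (gx - 1) * (a' - 1)‖ ≤ 2 * τ ^ 2 := by
    refine (norm_sub_le _ _).trans ?_
    rw [norm_mul, norm_mul]
    nlinarith [mul_le_mul hA hGy (norm_nonneg _) hτ0, mul_le_mul hGx hA' (norm_nonneg _) hτ0]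
  set m := Real.sqrt (∑ c, (vecPart A c - vecPart A' c + vecPart Gy c - vecPart Gx c) ^ 2) with hm
  have hsum0 : 0 ≤ ∑ c, (vecPart A c - vecPart A' c + vecPart Gy c - vecPart Gx c) ^ 2 := Finset.sum_nonneg fun c _ => sq_nonneg _
  have him : ℓ.imI ^ 2 + ℓ.imJ ^ 2 + ℓ.imK ^ 2 = ∑ c, (vecPart A c - vecPart A' c + vecPart Gy c - vecPart Gx c) ^ 2 := by
    simp only [Fin.sum_univ_three, vecPart, hℓ, ha, ha', hgx, hgy, Matrix.cons_val_zero, Matrix.cons_val_one, Matrix.cons_val_two,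
      Matrix.head_cons, Matrix.tail_cons, Quaternion.imI_add, Quaternion.imI_sub, Quaternion.imJ_add, Quaternion.imJ_sub,
      Quaternion.imK_add, Quaternion.imK_sub]
    ring
  have hmℓ : m ≤ ‖ℓ‖ := by rw [hm, ← him]; exact quat_sqrt_im_le_norm ℓ
  have hm0 : 0 ≤ m := Real.sqrt_nonneg _
  have hm2 : m ^ 2 = ∑ c, (vecPart A c - vecPart A' c + vecPart Gy c - vecPart Gx c) ^ 2 := by rw [hm, Real.sq_sqrt hsum0]
  -- `‖D‖ ≥ ‖ℓ‖ − 2τ² ≥ m − 2τ²`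
  have hD : m - 2 * τ ^ 2 ≤ ‖a * gy - gx * a'‖ := by
    rw [e]
    have h := norm_sub_norm_le ℓ (-((a - 1) * (gy - 1) - (gx - 1) * (a' - 1)))
    rw [sub_neg_eq_add, norm_neg] at h
    linarith
  have hD0 : 0 ≤ ‖a * gy - gx * a'‖ := norm_nonneg _
  have hτ4 : τ ^ 4 ≤ τ ^ 3 := by nlinarith [pow_nonneg hτ0 3]
  by_cases hcase : 2 * τ ^ 2 ≤ m
  · have hsq : (m - 2 * τ ^ 2) ^ 2 ≤ ‖a * gy - gx * a'‖ ^ 2 := pow_le_pow_left₀ (by linarith) hD 2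
    have hm4 : m ≤ 4 * τ := by
      have hℓ4 : ‖ℓ‖ ≤ 4 * τ := by
        have e2 : ℓ = (a - 1) - (a' - 1) + ((gy - 1) - (gx - 1)) := by rw [hℓ]; abel
        rw [e2]
        calc ‖(a - 1) - (a' - 1) + ((gy - 1) - (gx - 1))‖ ≤ ‖(a - 1) - (a' - 1)‖ + ‖(gy - 1) - (gx - 1)‖ := norm_add_le _ _
          _ ≤ (‖a - 1‖ + ‖a' - 1‖) + (‖gy - 1‖ + ‖gx - 1‖) := add_le_add (norm_sub_le _ _) (norm_sub_le _ _)
          _ ≤ 4 * τ := by linarith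
      exact hmℓ.trans hℓ4
    rw [← hm2]
    nlinarith [mul_le_mul_of_nonneg_left hm4 (by positivity : (0 : ℝ) ≤ 4 * τ ^ 2)]
  · rw [not_le] at hcase
    have hm2' : m ^ 2 ≤ 4 * τ ^ 4 := by nlinarith
    rw [← hm2]
    nlinarith [sq_nonneg ‖a * gy - gx * a'‖]

/-- ★★ **All links, from below**: `‖Ξ‖² − 16|E|τ³ ≤ kinDefect U V g`. [cite: Luscher1983, §3] -/
theorem kinDefect_ge_norm_sq_sub (U V : GaugeConfig 3 L SU2) (g : Site 3 L → SU2) {τ : ℝ} (hτ1 : τ ≤ 1)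
    (hU : ∀ e, ‖su2Quat (U e) - 1‖ ≤ τ) (hV : ∀ e, ‖su2Quat (V e) - 1‖ ≤ τ) (hg : ∀ z, ‖su2Quat (g z) - 1‖ ≤ τ) :
    ‖linkEmbed L (fun e a => vecPart (U e) a - vecPart (V e) a) + vacGrad L (fun z => vecPart (g z))‖ ^ 2 - 16 * Fintype.card (Edge 3 L) * τ ^ 3 ≤
      kinDefect L U V g := by
  have hnorm : ‖linkEmbed L (fun e a => vecPart (U e) a - vecPart (V e) a) + vacGrad L (fun z => vecPart (g z))‖ ^ 2 =
      ∑ e : Edge 3 L, ∑ a : Fin 3, (vecPart (U e) a - vecPart (V e) a + vecPart (g (e.1.shift e.2)) a - vecPart (g e.1) a) ^ 2 := by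
    rw [EuclideanSpace.norm_sq_eq, Fintype.sum_prod_type]
    refine Finset.sum_congr rfl fun e _ => Finset.sum_congr rfl fun a _ => ?_
    rw [Real.norm_eq_abs, sq_abs, PiLp.add_apply, linkEmbed_apply, vacGrad_apply]; ring
  rw [hnorm]
  unfold kinDefect
  have h := Finset.sum_le_sum (s := Finset.univ) fun e (_ : e ∈ Finset.univ) =>
    edge_defect_sq_ge (U e) (V e) (g e.1) (g (e.1.shift e.2)) hτ1 (hU e) (hV e) (hg _) (hg _)
  rw [Finset.sum_sub_distrib, Finset.sum_const, Finset.card_univ, nsmul_eq_mul] at h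
  linarith

/-- ★★ **The defect of the central tube against a based chart copy, from below**:
`‖linkEmbed (x − x') + ∇(flatLin w)‖² − 136|E|τ³ ≤ kinDefect (orthoTube 1 x) (orthoTube 1 x') (basedExt (gno ∘ w))` for `√2‖x̂‖, √2‖x̂'‖, √3‖w‖ ≤ τ ≤ 1`. [cite: Luscher1983, §3] -/
theorem kinDefect_central_based_ge {x x' : Edge 3 L → Fin 3 → ℝ} (hx : ∀ e, ∑ a, x e a ^ 2 ≤ 1) (hx' : ∀ e, ∑ a, x' e a ^ 2 ≤ 1)
    (w : NzSite L → Fin 3 → ℝ) {τ : ℝ} (hτ1 : τ ≤ 1) (hτx : Real.sqrt 2 * ‖linkEmbed L x‖ ≤ τ) (hτx' : Real.sqrt 2 * ‖linkEmbed L x'‖ ≤ τ)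
    (hτw : Real.sqrt 3 * ‖w‖ ≤ τ) :
    ‖linkEmbed L (x - x') + vacGrad L (flatLin L w : Site 3 L → Fin 3 → ℝ)‖ ^ 2 - 136 * Fintype.card (Edge 3 L) * τ ^ 3 ≤
      kinDefect L (orthoTube L 1 x) (orthoTube L 1 x') (basedExt L (fun y => gnoPoint (w y))) := by
  have hτ0 : 0 ≤ τ := le_trans (by positivity) hτw
  set n : ℝ := (Fintype.card (Edge 3 L) : ℝ) with hn
  have hn1 : 1 ≤ n := by
    have : 0 < Fintype.card (Edge 3 L) := Fintype.card_pos
    rw [hn]; exact_mod_cast this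
  have h1 := kinDefect_ge_norm_sq_sub (L := L) (orthoTube L 1 x) (orthoTube L 1 x') (basedExt L (fun y => gnoPoint (w y))) hτ1
    (fun e => (norm_su2Quat_orthoTube_one_sub_one_le hx e).trans hτx) (fun e => (norm_su2Quat_orthoTube_one_sub_one_le hx' e).trans hτx')
    (fun z => (norm_su2Quat_basedExt_gno_sub_one_le w z).trans hτw)
  rw [← hn] at h1
  have hvec : (linkEmbed L (fun e a => vecPart (orthoTube L 1 x e) a - vecPart (orthoTube L 1 x' e) a) +
      vacGrad L (fun z => vecPart (basedExt L (fun y => gnoPoint (w y)) z))) =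
      linkEmbed L (x - x') + vacGrad L (gnoParam L w : Site 3 L → Fin 3 → ℝ) := by
    have e1 : (fun e a => vecPart (orthoTube L 1 x e) a - vecPart (orthoTube L 1 x' e) a) = x - x' := by
      funext e a; rw [vecPart_orthoTube_one hx, vecPart_orthoTube_one hx']; rfl
    have e2 : (fun z => vecPart (basedExt L (fun y => gnoPoint (w y)) z)) = (gnoParam L w : Site 3 L → Fin 3 → ℝ) := by
      funext z; exact vecPart_basedExt_gno w z
    rw [e1, e2]
  rw [hvec] at h1
  set A := linkEmbed L (x - x') + vacGrad L (flatLin L w : Site 3 L → Fin 3 → ℝ) with hA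
  set B := vacGrad L ((gnoParam L w : Site 3 L → Fin 3 → ℝ) - (flatLin L w : Site 3 L → Fin 3 → ℝ)) with hB
  have hsplit : linkEmbed L (x - x') + vacGrad L (gnoParam L w : Site 3 L → Fin 3 → ℝ) = A + B := by
    have hB' : vacGrad L (gnoParam L w : Site 3 L → Fin 3 → ℝ) = vacGrad L (flatLin L w : Site 3 L → Fin 3 → ℝ) + B := by
      rw [hB, map_sub]; abel
    rw [hB', hA, add_assoc]
  have hw1 : ‖w‖ ≤ τ := by nlinarith [Real.sqrt_nonneg 3, Real.sq_sqrt (show (0 : ℝ) ≤ 3 by norm_num), norm_nonneg w]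
  have hB3 : ‖B‖ ≤ 4 * Real.sqrt (3 * n) * τ ^ 3 := by
    have hdiff : ‖((gnoParam L w : Site 3 L → Fin 3 → ℝ) - (flatLin L w : Site 3 L → Fin 3 → ℝ))‖ ≤ 2 * ‖w‖ ^ 3 := by
      have h := norm_gnoParam_sub_flatLin_le L w
      rw [← Submodule.coe_sub, Submodule.norm_coe]; exact h
    calc ‖B‖ ≤ 2 * Real.sqrt (3 * n) * ‖((gnoParam L w : Site 3 L → Fin 3 → ℝ) - (flatLin L w : Site 3 L → Fin 3 → ℝ))‖ := norm_vacGrad_le _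
      _ ≤ 2 * Real.sqrt (3 * n) * (2 * ‖w‖ ^ 3) := by gcongr
      _ ≤ 2 * Real.sqrt (3 * n) * (2 * τ ^ 3) := by gcongr
      _ = 4 * Real.sqrt (3 * n) * τ ^ 3 := by ring
  have hA1 : ‖A‖ ≤ 5 * Real.sqrt (3 * n) * τ := by
    have hxx : ‖linkEmbed L (x - x')‖ ≤ Real.sqrt 2 * τ := by
      rw [map_sub]
      have h2 : Real.sqrt 2 * Real.sqrt 2 = 2 := Real.mul_self_sqrt (by norm_num)
      calc ‖linkEmbed L x - linkEmbed L x'‖ ≤ ‖linkEmbed L x‖ + ‖linkEmbed L x'‖ := norm_sub_le _ _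
        _ ≤ Real.sqrt 2 * τ := by nlinarith [Real.sqrt_nonneg 2, norm_nonneg (linkEmbed L x), norm_nonneg (linkEmbed L x')]
    have hflat : ‖vacGrad L (flatLin L w : Site 3 L → Fin 3 → ℝ)‖ ≤ 2 * Real.sqrt (3 * n) * τ := by
      calc ‖vacGrad L (flatLin L w : Site 3 L → Fin 3 → ℝ)‖ ≤ 2 * Real.sqrt (3 * n) * ‖(flatLin L w : Site 3 L → Fin 3 → ℝ)‖ := norm_vacGrad_le _
        _ = 2 * Real.sqrt (3 * n) * ‖w‖ := by rw [← Submodule.coe_norm, norm_flatLin]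
        _ ≤ 2 * Real.sqrt (3 * n) * τ := by gcongr
    have hs2 : Real.sqrt 2 ≤ 3 * Real.sqrt (3 * n) := by
      have h3n : Real.sqrt 2 ≤ Real.sqrt (3 * n) := Real.sqrt_le_sqrt (by linarith)
      nlinarith [Real.sqrt_nonneg (3 * n)]
    calc ‖A‖ ≤ ‖linkEmbed L (x - x')‖ + ‖vacGrad L (flatLin L w : Site 3 L → Fin 3 → ℝ)‖ := norm_add_le _ _
      _ ≤ Real.sqrt 2 * τ + 2 * Real.sqrt (3 * n) * τ := add_le_add hxx hflat
      _ ≤ 5 * Real.sqrt (3 * n) * τ := by nlinarith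
  have h3n : Real.sqrt (3 * n) ^ 2 = 3 * n := Real.sq_sqrt (by positivity)
  -- `‖A + B‖² ≥ ‖A‖² − 2‖A‖‖B‖`
  have hAB : ‖A‖ ^ 2 - 120 * n * τ ^ 3 ≤ ‖A + B‖ ^ 2 := by
    have h0 : ‖A‖ - ‖B‖ ≤ ‖A + B‖ := by
      have := norm_sub_norm_le A (-B); rw [norm_neg, sub_neg_eq_add] at this; linarith
    have hmid : 2 * ‖A‖ * ‖B‖ ≤ 2 * (5 * Real.sqrt (3 * n) * τ) * (4 * Real.sqrt (3 * n) * τ ^ 3) := by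
      have := mul_le_mul hA1 hB3 (norm_nonneg _) (by positivity)
      nlinarith
    have e1 : (2 : ℝ) * (5 * Real.sqrt (3 * n) * τ) * (4 * Real.sqrt (3 * n) * τ ^ 3) = 40 * Real.sqrt (3 * n) ^ 2 * τ ^ 4 := by ring
    rw [e1, h3n] at hmid
    have hτ4 : τ ^ 4 ≤ τ ^ 3 := by nlinarith [pow_nonneg hτ0 3]
    by_cases hc : ‖B‖ ≤ ‖A‖
    · have hsq : (‖A‖ - ‖B‖) ^ 2 ≤ ‖A + B‖ ^ 2 := pow_le_pow_left₀ (by linarith) h0 2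
      nlinarith [sq_nonneg ‖B‖, mul_le_mul_of_nonneg_left hτ4 (by positivity : (0 : ℝ) ≤ 120 * n)]
    · rw [not_le] at hc
      have : ‖A‖ ^ 2 ≤ 2 * ‖A‖ * ‖B‖ := by nlinarith [norm_nonneg A]
      nlinarith [sq_nonneg ‖A + B‖, mul_le_mul_of_nonneg_left hτ4 (by positivity : (0 : ℝ) ≤ 120 * n)]
  rw [hsplit] at h1
  linarith

/-! ## §2 The based T-core in flat coordinates -/

omit [NeZero L] in
/-- On the core `‖q(gnoPoint v) − 1‖ ≤ T ≤ 1` the flat coordinate is small: `Σ_a v_a² ≤ 4T²`. [folklore] -/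
theorem sum_sq_le_of_gno_core {v : Fin 3 → ℝ} {T : ℝ} (hT1 : T ≤ 1) (h : ‖su2Quat (gnoPoint v) - 1‖ ≤ T) : ∑ a, v a ^ 2 ≤ 4 * T ^ 2 := by
  have hT0 : 0 ≤ T := (norm_nonneg _).trans h
  have h1 := one_sub_scalarPart_eq (gnoPoint v)
  obtain ⟨hs, hsA, -⟩ := gnoPoint_chart v
  set s := scalarPart (gnoPoint v)
  set u := ∑ a, v a ^ 2
  have hu : 0 ≤ u := Finset.sum_nonneg fun a _ => sq_nonneg _
  have hsq : ‖su2Quat (gnoPoint v) - 1‖ ^ 2 ≤ T ^ 2 := pow_le_pow_left₀ (norm_nonneg _) h 2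
  have hs1 : 1 - s ≤ T ^ 2 / 2 := by rw [h1]; linarith
  have hs12 : 1 / 2 ≤ s := by nlinarith
  -- `u = (1 − s²)/s² = (1−s)(1+s)/s² ≤ (T²/2)·2/s² ≤ 4T²`
  have hsle1 : s ≤ 1 := by nlinarith
  have e1 : u * s ^ 2 = 1 - s ^ 2 := by linear_combination hsA
  have e2 : 1 - s ^ 2 ≤ T ^ 2 := by nlinarith
  have e3 : (1 / 4) * u ≤ u * s ^ 2 := by nlinarith [mul_nonneg hu hs.le]
  linarith

/-- On the based T-core in the chart the flat sup norm is `≤ 2T`. [folklore] -/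
theorem norm_le_of_gno_core {w : NzSite L → Fin 3 → ℝ} {T : ℝ} (hT0 : 0 ≤ T) (hT1 : T ≤ 1) (h : ∀ y, ‖su2Quat (gnoPoint (w y)) - 1‖ ≤ T) : ‖w‖ ≤ 2 * T := by
  refine (pi_norm_le_iff_of_nonneg (by positivity)).2 fun y => (pi_norm_le_iff_of_nonneg (by positivity)).2 fun a => ?_
  have hs := sum_sq_le_of_gno_core hT1 (h y)
  have ha : w y a ^ 2 ≤ ∑ b, w y b ^ 2 := Finset.single_le_sum (f := fun b => w y b ^ 2) (fun b _ => sq_nonneg _) (Finset.mem_univ a)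
  rw [Real.norm_eq_abs]
  exact abs_le_of_sq_le_sq (by linarith) (by positivity)

omit [NeZero L] in
/-- On the based T-core (`T ≤ 1`) every factor lies in the open upper hemisphere. [folklore] -/
theorem scalarPart_pos_of_core {h : NzSite L → SU2} {T : ℝ} (hT1 : T ≤ 1) (hh : ∀ y, ‖su2Quat (h y) - 1‖ ≤ T) (y : NzSite L) : 0 < scalarPart (h y) := by
  have h1 := one_sub_scalarPart_eq (h y)
  have h2 : ‖su2Quat (h y) - 1‖ ^ 2 ≤ T ^ 2 := pow_le_pow_left₀ (norm_nonneg _) (hh y) 2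
  have hT0 : 0 ≤ T := (norm_nonneg _).trans (hh y)
  nlinarith


end Summit.QuantumFields.YangMills.Theorems.FemtoTransferGap.TwoLattice.ConstTube

end
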